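import Literature.Computability.AlgebraicComplexity.FermionicPencil
import Literature.Computability.AlgebraicComplexity.ValiantClassesProofs
import Summits.ValiantsHypothesis.ValiantsHypothesis.Theorems.FermionicJetJetsInVNPGadgets
import Summits.ValiantsHypothesis.ValiantsHypothesis.Theorems.DetQPDetqpThesisStubIsVNPFamilyHyperdet
import Summits.ValiantsHypothesis.ValiantsHypothesis.Theses.FermionicJet

/-!
# Route `FermionicJet`, item `JetsInVNP` (stmt-ValiantsHypothesis-5344): the cycle jets are in `VNP`

Item (support, rank 9): for every fixed order `k`, the `k`-th Taylor coefficient family of the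
fermionic pencil `t ↦ ∑_σ sgn σ · t^{c(σ)} x^σ` at the free-fermion point `t = 1`,
`f_{n,k} = ∑_σ sgn σ · binom(c(σ), k) ∏ᵢ X_{σ i, i}` (`c(σ)` = number of cycles including fixed
points), is a `VNP` family over `ℂ`. The route's inline sum is VERBATIM the tree's
`Literature.Computability.AlgebraicComplexity.cycleJetPoly (Fin n) ℂ k` (`FermionicPencil.lean`,
`Equiv.Perm.numCycles` unfolding to `card (cycleType σ) + #{i | σ i = i}`), and we prove
`IsVNPFamily (fun n => cycleJetPoly (Fin n) K k)` over every field `K` of characteristic zero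
(`isVNPFamily_cycleJetPoly`), literally in the format of Bürgisser 2000, Def. 2.5.

## The witness (Valiant's criterion, written out; no new definitions)

Boolean block: an `n × n` position matrix `Z` (variable `Sum.inr (finProdFinEquiv (t, i))`, "is
`σ t = i`"), recognised by BCS's `α(Z) β(Z)` (`conflictPairs`, `sum_recogniser_mul` of
`HamiltonianCycleVNP.lean`: Boolean sums against the recogniser are sums over permutation
matrices `P_σ`). The witness is

  `G_n = α(Z) β(Z) · (det Z · binom(c(Z), k) · ∏_t ∑_i Z_{(t,i)} X_{(i,t)})`,

where `det Z` (the generic determinant renamed to `Z`; `VP` by Berkowitz, `complexity_detPoly_le`)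
is `sgn σ` at `P_σ` (`Matrix.det_permutation`), the cover product is `∏_t X_{σ t, t}` at `P_σ`, and
`c(Z) = ∑_i ∑_{m=1}^{n} (1/m) (Z^m)_{ii} ∏_{1 ≤ l < m} (1 - (Z^l)_{ii})` is the CYCLE-COUNT gadget
of helper file 2: at `P_σ`, `(Z^m)_{ii} = [σ^m i = i]`, the inner first-return sum is `1/ℓ(i)`
(`ℓ(i)` the length of the cycle through `i`) and `∑ᵢ 1/ℓ(i) = c(σ)`; `binom(c, k) =
(1/k!) ∏_{j<k} (c - j)`. The powers `(Z^m)_{ii}` are instances of iterated matrix multiplication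
(`IMM ∈ VP`), so `G_n ∈ VP`: `2n²` variables, degree `≤ (k+6)(n+1)⁴`, size `≤ (10k+22)(n+1)⁷`
(`exists_witness`); and `∑_{e ∈ {0,1}^{n²}} G_n(X, e) = f_{n,k}` (`boolSum_witness`).

References: L. G. Valiant, *Completeness classes in algebra*, STOC 1979; P. Bürgisser,
*Completeness and Reduction in Algebraic Complexity Theory*, Springer 2000, Def. 2.3–2.5,
Prop. 2.20; P. Bürgisser, M. Clausen, M. A. Shokrollahi, *Algebraic Complexity Theory*, Springer
1997, Prop. (21.15).
-/

noncomputable section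

-- single-conjunct layout: Sub = Summit, duplicated namespace component intended
set_option linter.dupNamespace false

namespace Summit.ValiantsHypothesis.ValiantsHypothesis.Theorems.FermionicJetJetsInVNP

open Literature.Computability.AlgebraicComplexity MvPolynomial Equiv Finset

universe u

/-! ### Boolean points -/

section Points

variable (K : Type u) [Field K] (n : ℕ)

/-- `boolSum` over the Boolean block `Fin (n·n)` as a sum over Boolean `n × n` matrices `E`,
position variable `q` being set to `[E (finProdFinEquiv⁻¹ q)]`. [folklore] -/
theorem boolSum_eq_sum_matrices (g : MvPolynomial ((Fin n × Fin n) ⊕ Fin (n * n)) K) :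
    boolSum g = ∑ E : Fin n × Fin n → Bool,
      aeval (Sum.elim X fun q => if E (finProdFinEquiv.symm q) then
        (1 : MvPolynomial (Fin n × Fin n) K) else 0) g := by
  unfold boolSum
  refine Fintype.sum_equiv (Equiv.arrowCongr finProdFinEquiv.symm (Equiv.refl Bool)) _ _
    fun e => ?_
  congr 2
  funext v
  rcases v with q | j
  · rfl
  · simp only [Sum.elim_inr, Equiv.arrowCongr_apply, Function.comp_apply, Equiv.coe_refl, id_eq,
      Equiv.symm_symm, Equiv.apply_symm_apply]

variable {K n}

/-- At the point of `E`, the position variable of `p` is `[E p]`. [folklore] -/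
theorem aeval_point_X_inr (E : Fin n × Fin n → Bool) (p : Fin n × Fin n) :
    aeval (Sum.elim X fun q => if E (finProdFinEquiv.symm q) then
        (1 : MvPolynomial (Fin n × Fin n) K) else 0)
      (X (Sum.inr (finProdFinEquiv p)) : MvPolynomial ((Fin n × Fin n) ⊕ Fin (n * n)) K) =
      if E p then 1 else 0 := by
  simp only [aeval_X, Sum.elim_inr, Equiv.symm_apply_apply]

/-- At the point of `E`, the matrix variables stay. [folklore] -/
theorem aeval_point_X_inl (E : Fin n × Fin n → Bool) (q : Fin n × Fin n) :
    aeval (Sum.elim X fun q => if E (finProdFinEquiv.symm q) then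
        (1 : MvPolynomial (Fin n × Fin n) K) else 0)
      (X (Sum.inl q) : MvPolynomial ((Fin n × Fin n) ⊕ Fin (n * n)) K) = X q := by
  simp only [aeval_X, Sum.elim_inl]

/-- A `K`-algebra map on the five-fold product `a b (s c v)` (the shape of the witness). [folklore] -/
theorem map_mul₅ {A B : Type*} [CommSemiring A] [CommSemiring B] [Algebra K A] [Algebra K B]
    (f : A →ₐ[K] B) (a b s c v : A) : f (a * b * (s * c * v)) = f a * f b * (f s * f c * f v) := by
  simp only [map_mul]

/-- At the point of `E`, BCS's `α(Z)` is `∏ (1 - [E p][E q])` over conflicting pairs. [folklore] -/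
theorem aeval_point_alpha (E : Fin n × Fin n → Bool) :
    aeval (Sum.elim X fun q => if E (finProdFinEquiv.symm q) then
        (1 : MvPolynomial (Fin n × Fin n) K) else 0)
      (∏ pq ∈ conflictPairs n, (1 - X (Sum.inr (finProdFinEquiv pq.1)) *
          X (Sum.inr (finProdFinEquiv pq.2))) : MvPolynomial ((Fin n × Fin n) ⊕ Fin (n * n)) K) =
      ∏ pq ∈ conflictPairs n, (1 - (if E pq.1 then (1 : MvPolynomial (Fin n × Fin n) K) else 0) *
          (if E pq.2 then (1 : MvPolynomial (Fin n × Fin n) K) else 0)) := by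
  simp only [map_prod, map_sub, map_one, map_mul, aeval_point_X_inr]

/-- At the point of `E`, BCS's `β(Z)` is `∏_t ∑_i [E (t, i)]`. [folklore] -/
theorem aeval_point_beta (E : Fin n × Fin n → Bool) :
    aeval (Sum.elim X fun q => if E (finProdFinEquiv.symm q) then
        (1 : MvPolynomial (Fin n × Fin n) K) else 0)
      (∏ t : Fin n, ∑ i : Fin n, X (Sum.inr (finProdFinEquiv (t, i))) :
        MvPolynomial ((Fin n × Fin n) ⊕ Fin (n * n)) K) =
      ∏ t, ∑ i, (if E (t, i) then (1 : MvPolynomial (Fin n × Fin n) K) else 0) := by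
  simp only [map_prod, map_sum, aeval_point_X_inr]

/-- At the point of `P_σ`, the matrix `Z` of position variables goes entrywise to `[σ a = b]`
(the hypothesis of the gadget lemmas of helper file 2). [folklore] -/
theorem aeval_point_Z (σ : Perm (Fin n)) (a b : Fin n) :
    aeval (Sum.elim X fun q => if permGraph σ (finProdFinEquiv.symm q) then
        (1 : MvPolynomial (Fin n × Fin n) K) else 0)
      ((Matrix.of fun a b => (X (Sum.inr (finProdFinEquiv (a, b))) :
        MvPolynomial ((Fin n × Fin n) ⊕ Fin (n * n)) K)) a b) = if σ a = b then 1 else 0 := by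
  rw [Matrix.of_apply, aeval_point_X_inr]
  simp [permGraph]

/-- At the point of `P_σ`, `det Z = sgn σ`. [folklore] -/
theorem aeval_point_sign (σ : Perm (Fin n)) :
    aeval (Sum.elim X fun q => if permGraph σ (finProdFinEquiv.symm q) then
        (1 : MvPolynomial (Fin n × Fin n) K) else 0)
      (rename (fun p => Sum.inr (finProdFinEquiv p)) (detPoly (Fin n) K) :
        MvPolynomial ((Fin n × Fin n) ⊕ Fin (n * n)) K) = C (((Equiv.Perm.sign σ : ℤ)) : K) := by
  rw [DetQPDetqpThesis.HyperdetVNP.aeval_rename_detPoly]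
  have h : (Matrix.of fun t i => Sum.elim X (fun q => if permGraph σ (finProdFinEquiv.symm q) then
      (1 : MvPolynomial (Fin n × Fin n) K) else 0) (Sum.inr (finProdFinEquiv (t, i)))) =
      Matrix.of fun t i => if permGraph σ (t, i) then (1 : MvPolynomial (Fin n × Fin n) K) else 0 := by
    refine Matrix.ext fun t i => ?_
    simp only [Matrix.of_apply, Sum.elim_inr, Equiv.symm_apply_apply]
  rw [h, of_permGraph_eq_permMatrix, Matrix.det_permutation, map_intCast]

/-- At the point of `P_σ`, the cover product is the monomial `∏_t X_{σ t, t}`. [folklore] -/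
theorem aeval_point_cover (σ : Perm (Fin n)) :
    aeval (Sum.elim X fun q => if permGraph σ (finProdFinEquiv.symm q) then
        (1 : MvPolynomial (Fin n × Fin n) K) else 0)
      (∏ t : Fin n, ∑ i : Fin n, X (Sum.inr (finProdFinEquiv (t, i))) * X (Sum.inl (i, t)) :
        MvPolynomial ((Fin n × Fin n) ⊕ Fin (n * n)) K) = ∏ t : Fin n, X (σ t, t) := by
  simp only [map_prod, map_sum, map_mul, aeval_point_X_inr, aeval_point_X_inl]
  refine Finset.prod_congr rfl fun t _ => ?_
  rw [Finset.sum_eq_single (σ t)]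
  · simp [permGraph]
  · intro i _ hi
    simp [permGraph, Ne.symm hi]
  · simp

end Points

/-! ### The witness: Boolean sum, degree, size -/

section Witness

variable (K : Type u) [Field K] (n : ℕ)

/-- **The Boolean sum of the witness is the `r`-th cycle jet**:
`∑_{e ∈ {0,1}^{n²}} G_n(X, e) = ∑_σ sgn σ · binom(c(σ), r) ∏_t X_{σ t, t}` (BCS 1997, Prop. (21.15):
(A)–(D) for the recogniser; the gadgets at `P_σ`). [folklore] -/
theorem boolSum_witness [CharZero K] (r : ℕ) :
    boolSum ((∏ pq ∈ conflictPairs n, (1 - X (Sum.inr (finProdFinEquiv pq.1)) *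
          X (Sum.inr (finProdFinEquiv pq.2)))) *
        (∏ t : Fin n, ∑ i : Fin n, X (Sum.inr (finProdFinEquiv (t, i)))) *
        (rename (fun p => Sum.inr (finProdFinEquiv p)) (detPoly (Fin n) K) *
          (C ((Nat.factorial r : K))⁻¹ * ∏ j ∈ Finset.range r,
            ((∑ i : Fin n, ∑ m ∈ Finset.Icc 1 n, C ((m : K)⁻¹) *
              ((Matrix.of fun a b => (X (Sum.inr (finProdFinEquiv (a, b))) :
                MvPolynomial ((Fin n × Fin n) ⊕ Fin (n * n)) K)) ^ m) i i *
              ∏ l ∈ Finset.Ico 1 m, (1 - ((Matrix.of fun a b =>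
                (X (Sum.inr (finProdFinEquiv (a, b))) :
                  MvPolynomial ((Fin n × Fin n) ⊕ Fin (n * n)) K)) ^ l) i i)) - C (j : K))) *
          ∏ t : Fin n, ∑ i : Fin n, X (Sum.inr (finProdFinEquiv (t, i))) * X (Sum.inl (i, t))) :
      MvPolynomial ((Fin n × Fin n) ⊕ Fin (n * n)) K) = cycleJetPoly (Fin n) K r := by
  rw [boolSum_eq_sum_matrices]
  simp only [map_mul₅, aeval_point_alpha, aeval_point_beta]
  refine (sum_recogniser_mul _).trans ?_
  unfold cycleJetPoly
  refine Finset.sum_congr rfl fun σ _ => ?_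
  rw [aeval_point_sign, map_choose _ _ σ (aeval_point_Z σ), aeval_point_cover, ← C_mul]
  congr 2
  push_cast
  ring

/-- **Degree of the witness**: `≤ (r+6)(n+1)⁴`. [folklore] -/
theorem totalDegree_witness_le (r : ℕ) :
    ((∏ pq ∈ conflictPairs n, (1 - X (Sum.inr (finProdFinEquiv pq.1)) *
          X (Sum.inr (finProdFinEquiv pq.2)))) *
        (∏ t : Fin n, ∑ i : Fin n, X (Sum.inr (finProdFinEquiv (t, i)))) *
        (rename (fun p => Sum.inr (finProdFinEquiv p)) (detPoly (Fin n) K) *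
          (C ((Nat.factorial r : K))⁻¹ * ∏ j ∈ Finset.range r,
            ((∑ i : Fin n, ∑ m ∈ Finset.Icc 1 n, C ((m : K)⁻¹) *
              ((Matrix.of fun a b => (X (Sum.inr (finProdFinEquiv (a, b))) :
                MvPolynomial ((Fin n × Fin n) ⊕ Fin (n * n)) K)) ^ m) i i *
              ∏ l ∈ Finset.Ico 1 m, (1 - ((Matrix.of fun a b =>
                (X (Sum.inr (finProdFinEquiv (a, b))) :
                  MvPolynomial ((Fin n × Fin n) ⊕ Fin (n * n)) K)) ^ l) i i)) - C (j : K))) *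
          ∏ t : Fin n, ∑ i : Fin n, X (Sum.inr (finProdFinEquiv (t, i))) * X (Sum.inl (i, t))) :
      MvPolynomial ((Fin n × Fin n) ⊕ Fin (n * n)) K).totalDegree ≤ (r + 6) * (n + 1) ^ 4 := by
  have hA : (∏ pq ∈ conflictPairs n, (1 - X (Sum.inr (finProdFinEquiv pq.1)) *
      X (Sum.inr (finProdFinEquiv pq.2))) :
      MvPolynomial ((Fin n × Fin n) ⊕ Fin (n * n)) K).totalDegree ≤ n ^ 4 * 2 :=
    (totalDegree_prod_le_of_le _ _ _ fun _ _ => totalDegree_one_sub_X_mul_X_le _ _).trans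
      (Nat.mul_le_mul_right 2 (card_conflictPairs_le _))
  have hB : (∏ t : Fin n, ∑ i : Fin n, X (Sum.inr (finProdFinEquiv (t, i))) :
      MvPolynomial ((Fin n × Fin n) ⊕ Fin (n * n)) K).totalDegree ≤ n * 1 :=
    (totalDegree_prod_le_of_le _ _ _ fun _ _ =>
      totalDegree_sum_le_of_le _ _ _ fun _ _ => totalDegree_X_le_one _).trans (by simp)
  have hS : (rename (fun p => Sum.inr (finProdFinEquiv p)) (detPoly (Fin n) K) :
      MvPolynomial ((Fin n × Fin n) ⊕ Fin (n * n)) K).totalDegree ≤ n :=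
    (totalDegree_rename_le _ _).trans
      (detPoly_isHomogeneous.totalDegree_le.trans (Fintype.card_fin n).le)
  have hCh := totalDegree_choose_le (K := K)
    (Matrix.of fun a b => (X (Sum.inr (finProdFinEquiv (a, b))) :
      MvPolynomial ((Fin n × Fin n) ⊕ Fin (n * n)) K)) (fun _ _ => totalDegree_X_le_one _) r
  have hV : (∏ t : Fin n, ∑ i : Fin n, X (Sum.inr (finProdFinEquiv (t, i))) * X (Sum.inl (i, t)) :
      MvPolynomial ((Fin n × Fin n) ⊕ Fin (n * n)) K).totalDegree ≤ n * 2 := by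
    refine (totalDegree_prod_le_of_le _ _ 2 fun t _ =>
      totalDegree_sum_le_of_le _ _ 2 fun i _ => ?_).trans (by simp)
    exact (totalDegree_mul _ _).trans (add_le_add (totalDegree_X_le_one _) (totalDegree_X_le_one _))
  refine (totalDegree_mul _ _).trans ((add_le_add ((totalDegree_mul _ _).trans (add_le_add hA hB))
    ((totalDegree_mul _ _).trans (add_le_add ((totalDegree_mul _ _).trans (add_le_add hS hCh))
      hV))).trans ?_)
  have e1 : n ^ 4 ≤ (n + 1) ^ 4 := pow_le_pow_succ n le_rfl
  have e2 : n ≤ (n + 1) ^ 4 := (pow_one n).symm.le.trans (pow_le_pow_succ n (by norm_num))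
  have e3 : r * (n + n * n) ≤ r * (n + 1) ^ 4 := by
    refine Nat.mul_le_mul_left r ?_
    calc n + n * n ≤ (n + 1) ^ 2 := by nlinarith
      _ ≤ (n + 1) ^ 4 := Nat.pow_le_pow_right n.succ_pos (by norm_num)
  have e4 : (r + 6) * (n + 1) ^ 4 = r * (n + 1) ^ 4 + 6 * (n + 1) ^ 4 := by ring
  omega

/-- **Size of the witness**: `≤ (10r+22)(n+1)⁷`. [folklore] -/
theorem complexity_witness_le (r : ℕ) :
    complexity ((∏ pq ∈ conflictPairs n, (1 - X (Sum.inr (finProdFinEquiv pq.1)) *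
          X (Sum.inr (finProdFinEquiv pq.2)))) *
        (∏ t : Fin n, ∑ i : Fin n, X (Sum.inr (finProdFinEquiv (t, i)))) *
        (rename (fun p => Sum.inr (finProdFinEquiv p)) (detPoly (Fin n) K) *
          (C ((Nat.factorial r : K))⁻¹ * ∏ j ∈ Finset.range r,
            ((∑ i : Fin n, ∑ m ∈ Finset.Icc 1 n, C ((m : K)⁻¹) *
              ((Matrix.of fun a b => (X (Sum.inr (finProdFinEquiv (a, b))) :
                MvPolynomial ((Fin n × Fin n) ⊕ Fin (n * n)) K)) ^ m) i i *
              ∏ l ∈ Finset.Ico 1 m, (1 - ((Matrix.of fun a b =>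
                (X (Sum.inr (finProdFinEquiv (a, b))) :
                  MvPolynomial ((Fin n × Fin n) ⊕ Fin (n * n)) K)) ^ l) i i)) - C (j : K))) *
          ∏ t : Fin n, ∑ i : Fin n, X (Sum.inr (finProdFinEquiv (t, i))) * X (Sum.inl (i, t))) :
      MvPolynomial ((Fin n × Fin n) ⊕ Fin (n * n)) K) ≤ (10 * r + 22) * (n + 1) ^ 7 := by
  have hA : complexity (∏ pq ∈ conflictPairs n, (1 - X (Sum.inr (finProdFinEquiv pq.1)) *
      X (Sum.inr (finProdFinEquiv pq.2))) :
      MvPolynomial ((Fin n × Fin n) ⊕ Fin (n * n)) K) ≤ n ^ 4 * 3 + n ^ 4 := by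
    refine (complexity_prod_le_of_le _ _ _ fun _ _ => complexity_one_sub_X_mul_X_le _ _).trans ?_
    have h := card_conflictPairs_le n
    gcongr
  have hB : complexity (∏ t : Fin n, ∑ i : Fin n, X (Sum.inr (finProdFinEquiv (t, i))) :
      MvPolynomial ((Fin n × Fin n) ⊕ Fin (n * n)) K) ≤ n * (n * 0 + n) + n :=
    (complexity_prod_le_of_le _ _ _ fun _ _ => complexity_sum_le_of_le _ _ _ fun _ _ =>
      le_of_eq (complexity_X_holds (k := K) _)).trans (by simp)
  have hS : complexity (rename (fun p => Sum.inr (finProdFinEquiv p)) (detPoly (Fin n) K) :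
      MvPolynomial ((Fin n × Fin n) ⊕ Fin (n * n)) K) ≤ 8 * (n + 1) ^ 7 :=
    (complexity_rename_le_holds' _ _).trans (complexity_detPoly_le K n)
  have hCh := complexity_choose_le (K := K)
    (Matrix.of fun a b => (X (Sum.inr (finProdFinEquiv (a, b))) :
      MvPolynomial ((Fin n × Fin n) ⊕ Fin (n * n)) K)) (fun _ _ => complexity_X_holds _) r
  have hV : complexity (∏ t : Fin n, ∑ i : Fin n,
      X (Sum.inr (finProdFinEquiv (t, i))) * X (Sum.inl (i, t)) :
      MvPolynomial ((Fin n × Fin n) ⊕ Fin (n * n)) K) ≤ n * (n * 1 + n) + n := by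
    refine (complexity_prod_le_of_le _ _ _ fun t _ =>
      complexity_sum_le_of_le _ _ 1 fun i _ => ?_).trans (by simp)
    have h1 := complexity_mul_le_holds
      (X (Sum.inr (finProdFinEquiv (t, i))) : MvPolynomial ((Fin n × Fin n) ⊕ Fin (n * n)) K)
      (X (Sum.inl (i, t)))
    have h2 := complexity_X_holds (k := K) (Sum.inr (finProdFinEquiv (t, i)) :
      (Fin n × Fin n) ⊕ Fin (n * n))
    have h3 := complexity_X_holds (k := K) (Sum.inl (i, t) : (Fin n × Fin n) ⊕ Fin (n * n))
    omega
  refine (complexity_mul_le_holds _ _).trans ?_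
  refine (Nat.succ_le_succ (add_le_add ((complexity_mul_le_holds _ _).trans
    (Nat.succ_le_succ (add_le_add hA hB)))
    ((complexity_mul_le_holds _ _).trans (Nat.succ_le_succ (add_le_add
      ((complexity_mul_le_holds _ _).trans (Nat.succ_le_succ (add_le_add hS hCh))) hV))))).trans ?_
  have e1 : n ^ 4 ≤ (n + 1) ^ 7 := pow_le_pow_succ n (by norm_num)
  have e2 : n * (n * 0 + n) + n ≤ 2 * (n + 1) ^ 7 := by
    have : n ^ 2 ≤ (n + 1) ^ 7 := pow_le_pow_succ n (by norm_num)
    have : n ≤ (n + 1) ^ 7 := (pow_one n).symm.le.trans (pow_le_pow_succ n (by norm_num))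
    nlinarith
  have e3 : n * (n * 1 + n) + n ≤ 3 * (n + 1) ^ 7 := by
    have : n ^ 2 ≤ (n + 1) ^ 7 := pow_le_pow_succ n (by norm_num)
    have : n ≤ (n + 1) ^ 7 := (pow_one n).symm.le.trans (pow_le_pow_succ n (by norm_num))
    nlinarith
  have e4 : 1 ≤ (n + 1) ^ 7 := Nat.one_le_pow _ _ n.succ_pos
  have e5 : (10 * r + 22) * (n + 1) ^ 7 = (10 * r + 1) * (n + 1) ^ 7 + 21 * (n + 1) ^ 7 := by ring
  omega

/-- **The `VNP` witness for the `r`-th cycle jet**, Boolean block `Fin (n·n)`: degree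
`≤ (r+6)(n+1)⁴`, size `≤ (10r+22)(n+1)⁷`, Boolean sum `J_{n,r}`. [folklore] -/
theorem exists_witness [CharZero K] (r : ℕ) :
    ∃ g : MvPolynomial ((Fin n × Fin n) ⊕ Fin (n * n)) K,
      g.totalDegree ≤ (r + 6) * (n + 1) ^ 4 ∧ complexity g ≤ (10 * r + 22) * (n + 1) ^ 7 ∧
        boolSum g = cycleJetPoly (Fin n) K r :=
  ⟨_, totalDegree_witness_le K n r, complexity_witness_le K n r, boolSum_witness K n r⟩

end Witness

/-! ### The family -/

section Family

variable (K : Type u) [Field K]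

/-- `deg J_{n,r} ≤ n` (each term is `± binom · ∏_{i<n} X_{σ i, i}`). [folklore] -/
theorem totalDegree_cycleJetPoly_le (n r : ℕ) : (cycleJetPoly (Fin n) K r).totalDegree ≤ n := by
  unfold cycleJetPoly
  refine totalDegree_sum_le_of_le _ _ _ fun σ _ => (totalDegree_mul _ _).trans ?_
  rw [totalDegree_C, zero_add]
  exact (totalDegree_prod_le_of_le _ _ 1 fun _ _ => totalDegree_X_le_one _).trans (by simp)

/-- **The cycle jets form a p-family**: `n²` variables, degree `≤ n`. [folklore] -/
theorem isPFamily_cycleJetPoly (r : ℕ) : IsPFamily fun n => cycleJetPoly (Fin n) K r := by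
  refine ⟨(IsPBounded.iff_exists_le_mul_succ_pow _).2 ⟨1, 2, fun n => ?_⟩,
    IsPBounded.id.mono fun n => totalDegree_cycleJetPoly_le K n r⟩
  have h : 1 * (n + 1) ^ 2 = n * n + 2 * n + 1 := by ring
  simp only [Fintype.card_prod, Fintype.card_fin]
  omega

/-- **The cycle jets are p-definable** over every field of characteristic zero: for every fixed
order `r`, `(J_{n,r})_n = (∑_σ sgn σ · binom(c(σ), r) ∏ᵢ X_{σ i, i})_n ∈ VNP` — Valiant's criterion
in the format of Bürgisser 2000, Def. 2.5: `J_{n,r}` is the Boolean sum of length `n²` of a `VP`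
witness (`exists_witness`). [folklore] -/
theorem isVNPFamily_cycleJetPoly [CharZero K] (r : ℕ) :
    IsVNPFamily fun n => cycleJetPoly (Fin n) K r := by
  choose g hdeg hcomp hsum using fun n => exists_witness K n r
  refine ⟨isPFamily_cycleJetPoly K r, fun n => n * n, g,
    ⟨⟨(IsPBounded.iff_exists_le_mul_succ_pow _).2 ⟨2, 2, fun n => ?_⟩,
      (IsPBounded.iff_exists_le_mul_succ_pow _).2 ⟨r + 6, 4, hdeg⟩⟩,
      (IsPBounded.iff_exists_le_mul_succ_pow _).2 ⟨10 * r + 22, 7, hcomp⟩⟩, fun n => (hsum n).symm⟩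
  have h : 2 * (n + 1) ^ 2 = 2 * (n * n) + 4 * n + 2 := by ring
  simp only [Fintype.card_sum, Fintype.card_prod, Fintype.card_fin]
  omega

end Family

end Summit.ValiantsHypothesis.ValiantsHypothesis.Theorems.FermionicJetJetsInVNP

namespace Summit.ValiantsHypothesis.ValiantsHypothesis.Theorems

/-- **Settles `stmt-ValiantsHypothesis-5344` (`JetsInVNP`, route `FermionicJet`)**: every
fixed-order jet family `f_{·,k} = ∑_σ sgn σ · binom(c(σ), k) x^σ` of the fermionic pencil at
`t = 1` is in `VNP` over `ℂ` (the route's inline sum is `cycleJetPoly (Fin n) ℂ k` verbatim;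
`FermionicJetJetsInVNP.isVNPFamily_cycleJetPoly`). [folklore] -/
theorem jetsInVNP_proof :
    Summit.ValiantsHypothesis.ValiantsHypothesis.Theses.FermionicJet.JetsInVNP := by
  unfold Summit.ValiantsHypothesis.ValiantsHypothesis.Theses.FermionicJet.JetsInVNP
  intro k
  exact FermionicJetJetsInVNP.isVNPFamily_cycleJetPoly ℂ k

end Summit.ValiantsHypothesis.ValiantsHypothesis.Theorems

end
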